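import Summits.ResolutionOfSingularities.ResolutionOfSingularities.Theorems.HilbertSamuelEliminationSigmaMaxModificationsCorridor3HypersurfacePoints
import Summits.ResolutionOfSingularities.ResolutionOfSingularities.Theorems.HilbertSamuelEliminationSigmaMaxModificationsCorridor3HypersurfaceValues
import Literature.AlgebraicGeometry.CossartJannsenSaito2020.KeyTheoremsIsolated
import Literature.AlgebraicGeometry.Resolution.FormalFibresRegularDerivations
import Literature.AlgebraicGeometry.Resolution.RegularLocalRingsNormal
import Literature.AlgebraicGeometry.Resolution.HilbertSamuelLocal
import Literature.RingTheory.HilbertSamuel.BennettRegularCentreDim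
import Literature.RingTheory.HilbertSamuel.PsiSemicontinuity
import HarnessLib

/-!
# [OURS · L1 W4.2] D14 ROUTE H — object H7: THE ARC IS IN THE `ν`-STRATUM. For a hypersurface `A = R/(h)` in a
# regular local ring `R`, a prime `P` with `R/P` regular of dimension one and `h ∈ P^m`, `ord_𝔪 h = m`: the point
# `P/(h)` of `Spec A` has the same Hilbert–Samuel function as the closed point, so the closed point is NOT isolated in
# the Hilbert–Samuel locus

Cell res-hironaka, rung L, slot W4.2 (crux `SigmaMaxModificationsCorridor3`, stmt-ResolutionOfSingularities-19249); row
`stub_Wtop3M_pointed`, KERNEL K1 `IsoFreeRationalTailsImpossible`; res-L1-w42-lead-1's D14 BRIDGE CUT, ROUTE H, object **H7**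
(«`R̂` regular, `P̂ = (Ŷ₁,Ŷ₂,Ŷ₃)`, `h ∈ P̂^m`, `ord_𝔪̂ h = m` ⇒ `ord_{R̂_P̂} h = m` ⇒ `H(P̂/(h)) = H(𝔪̂/(h))` ⇒ `𝔪̂` NOT isolated in
the HS-max locus of `Spec R̂/(h)`»), dealt to res-type-001 (RULINGS v3.14-2 (AZ)). Typed for ANY regular local ring `R` (complete
or not) of dimension `d + 1` and ANY prime `P` with `R ⧸ P` regular of dimension `1` (the arc); the arc `t ↦ (t, 0, …, 0)` of the
bridge cut is `P = (x₁, …, x_d)` for a regular system of parameters `(x₀, …, x_d)`.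

RING LEVEL (§1–§2, NO symbolic powers, NO completeness): `A = R/(h)` has `H^{(0)}(A) = hypersurfaceHFe (d+1) m` (stub-1's H1′);
`A_P̄ ≅ R_P/(h)` with `R_P` regular of dimension `d` (Serre, tree `isRegularLocalRing_localization_atPrime`; `ht P = d` by the
dimension formula in the catenary ring `R`) and `ord_{R_P} h =: m′ ≥ m` (`h ∈ P^m`), so `H^{(1)}(A_P̄) = (hypersurfaceHFe d m′)^{(1)}
= hypersurfaceHFe (d+1) m′ ≥ hypersurfaceHFe (d+1) m = H^{(0)}(A)`; Bennett's inequality for the REGULAR centre `A/P̄ ≅ R/P`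
(`hilbertSamuelFun_localization_le_hilbertFun_of_isRegularLocalRing_quotient`, HIO Prop. (30.1)) gives `≤`, hence
**`H^{(1)}(A_P̄) = H^{(0)}(A)`** (`hilbertSamuelFun_one_localization_eq_hilbertFun`: by Bennett's criterion, `A` is normally flat
along the arc) and `m′ = m`.

SCHEME LEVEL (§3): in `X = Spec A`, `ψ(𝔪̄) = d`, `ψ(P̄) = d − 1` (hypersurfaces are equidimensional,
`Helpers.minimalPrimesCodim_quotient_span_singleton`), so `H^N_X(P̄) = (H^{(1)}(A_P̄))^{(N−d)} = (H^{(0)}(A))^{(N−d)} = H^N_X(𝔪̄)`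
(`hsFun_arcPoint_eq_hsFun_closedPoint`), and since `P̄ ⤳ 𝔪̄`, `P̄ ≠ 𝔪̄`, every open neighbourhood of the closed point meets the
HS-max locus in `P̄` too: **`not_isIsolatedInHSMaxLocus_closedPoint_of_arc`**.

[OURS · L1 W4.2] bookkeeping over the tree's Bennett / hypersurface Hilbert–Samuel library; NOT a statement of any source, and NOT a
statement of H. Hironaka's 2017 manuscript. AI-written (res-type-001 g7); AI review is weaker than expert review.
-/

set_option linter.dupNamespace false

noncomputable section

open CategoryTheory AlgebraicGeometry TopologicalSpace IsLocalRing
open Literature.AlgebraicGeometry.Resolution Literature.RingTheory.HilbertSamuel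
open Literature.AlgebraicGeometry.CossartJannsenSaito2020
open Summit.ResolutionOfSingularities.ResolutionOfSingularities.Theorems.SigmaMaxModificationsCorridor3.Helpers

namespace Summit.ResolutionOfSingularities.ResolutionOfSingularities.Theorems.SigmaMaxModificationsCorridor3.IsoTailsHS

universe u

/-! ## §1. Elementary bookkeeping -/

section Basic

variable {R : Type u} [CommRing R] [IsRegularLocalRing R]

/-- **`ht P = d`** for a prime `P` with `R/P` regular of dimension `1` in a regular local ring of dimension `d + 1` (dimension
formula `ht 𝔪 = ht P + ht(𝔪/P)` in the catenary ring `R`). [cite: Matsumura1987, §5 (p. 31), Thm. 17.4] -/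
theorem height_prime_of_arc {d : ℕ} (hd : ringKrullDim R = (d + 1 : ℕ)) (P : Ideal R) [P.IsPrime]
    [IsRegularLocalRing (R ⧸ P)] (hP1 : ringKrullDim (R ⧸ P) = (1 : ℕ)) : P.height = d := by
  haveI : IsDomain R := isDomain_of_isRegularLocalRing R
  have hcat := (isCatenaryRing_of_isRegularLocalRing R).height_eq_height_add_height_map_quotientMk
    (IsLocalRing.le_maximalIdeal (Ideal.IsPrime.ne_top ‹_›) : P ≤ maximalIdeal R)
  have hmR : (maximalIdeal R).height = (d + 1 : ℕ) := by
    have h := IsLocalRing.maximalIdeal_height_eq_ringKrullDim (R := R)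
    rw [hd] at h
    exact_mod_cast h
  have hmP : (maximalIdeal (R ⧸ P)).height = (1 : ℕ) := by
    have h := IsLocalRing.maximalIdeal_height_eq_ringKrullDim (R := R ⧸ P)
    rw [hP1] at h
    exact_mod_cast h
  rw [IsLocalRing.map_maximalIdeal_of_surjective _ Ideal.Quotient.mk_surjective, hmR, hmP] at hcat
  have hle : P.height ≤ (d + 1 : ℕ) := hcat ▸ le_self_add
  have hfin : P.height ≠ ⊤ := ne_top_of_le_ne_top (ENat.coe_ne_top _) hle
  obtain ⟨r, hr⟩ := ENat.ne_top_iff_exists.mp hfin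
  rw [← hr] at hcat ⊢
  have : (d + 1 : ℕ) = r + 1 := by exact_mod_cast hcat
  exact_mod_cast (show r = d by omega)

/-- `dim R_P = d` for such a prime. [cite: Matsumura1987, Thm. 17.4] -/
theorem ringKrullDim_localization_of_arc {d : ℕ} (hd : ringKrullDim R = (d + 1 : ℕ)) (P : Ideal R) [P.IsPrime]
    [IsRegularLocalRing (R ⧸ P)] (hP1 : ringKrullDim (R ⧸ P) = (1 : ℕ)) :
    ringKrullDim (Localization.AtPrime P) = (d : ℕ) := by
  rw [IsLocalization.AtPrime.ringKrullDim_eq_height P (Localization.AtPrime P), height_prime_of_arc hd P hP1]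
  rfl

/-- `R/(h)` is a local ring for `h ∈ 𝔪`. [folklore] -/
theorem isLocalRing_quotient_span_singleton_of_mem {h : R} (hh : h ∈ maximalIdeal R) :
    IsLocalRing (R ⧸ Ideal.span {h}) :=
  haveI : Nontrivial (R ⧸ Ideal.span {h}) := Ideal.Quotient.nontrivial_iff.mpr (by
    rw [Ne, Ideal.span_singleton_eq_top]
    exact fun hu => (IsLocalRing.mem_maximalIdeal h).mp hh hu)
  .of_surjective' (Ideal.Quotient.mk _) Ideal.Quotient.mk_surjective

omit [IsRegularLocalRing R] in
/-- `P̄ = P/(h)` is a prime of `R/(h)` for `h ∈ P`. [folklore] -/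
theorem isPrime_map_quotientMk_of_mem {P : Ideal R} [P.IsPrime] {h : R} (hhP : h ∈ P) :
    (P.map (Ideal.Quotient.mk (Ideal.span {h}))).IsPrime :=
  Ideal.isPrime_map_quotientMk_of_isPrime ((Ideal.span_singleton_le_iff_mem _).mpr hhP)

end Basic

/-! ## §2. Ring level: the order of `h` at `P` equals `m`, and `H^{(1)}(A_P̄) = H^{(0)}(A)` -/

/-- **H7, ring level (D14 ROUTE H): `H^{(1)}(A_P̄) = H^{(0)}(A) = hypersurfaceHFe (d+1) m` and `ord_{R_P} h = m`** for
`A = R/(h)`, `R` regular local of dimension `d + 1`, `P` a prime with `R/P` regular of dimension `1`, `h ∈ P^m`, `h ∉ 𝔪^{m+1}`,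
`m ≥ 1`, and ANY localization `Ap` of `A` at `P̄ = P/(h)`: the localization of the hypersurface at the arc has the Hilbert function of
a hypersurface of multiplicity `m′ = ord_{R_P} h ≥ m` in the regular ring `R_P` of dimension `d` (Serre), its first partial sum is
`hypersurfaceHFe (d+1) m′ ≥ hypersurfaceHFe (d+1) m = H^{(0)}(A)` (stub-1's H1′, `ψ`-shift), and Bennett's inequality for the regular
centre `A/P̄ ≅ R/P` gives `≤`; hence equality and `m′ = m` — by Bennett's criterion `A` is normally flat along the arc («the arc lies
in the `ν`-stratum»). [cite: HerrmannIkedaOrbanz1988, Prop. (30.1)] [cite: CossartJannsenSaito2020, Thm. 2.3, Thm. 3.3] -/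
theorem hilbertSamuelFun_one_localization_eq_hilbertFun {R : Type u} [CommRing R] [IsRegularLocalRing R] {d : ℕ}
    (hd : ringKrullDim R = (d + 1 : ℕ)) (P : Ideal R) [P.IsPrime] [IsRegularLocalRing (R ⧸ P)]
    (hP1 : ringKrullDim (R ⧸ P) = (1 : ℕ)) {m : ℕ} (hm : 1 ≤ m) {h : R} (hhP : h ∈ P ^ m)
    (hh : h ∉ maximalIdeal R ^ (m + 1)) [(P.map (Ideal.Quotient.mk (Ideal.span {h}))).IsPrime]
    [IsLocalRing (R ⧸ Ideal.span {h})]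
    (Ap : Type u) [CommRing Ap] [Algebra (R ⧸ Ideal.span {h}) Ap]
    [IsLocalization.AtPrime Ap (P.map (Ideal.Quotient.mk (Ideal.span {h})))] [IsLocalRing Ap] :
    hilbertSamuelFun Ap 1 = hilbertFun (R ⧸ Ideal.span {h}) ∧
      hilbertFun (R ⧸ Ideal.span {h}) = hypersurfaceHFe (d + 1) m ∧
      algebraMap R (Localization.AtPrime P) h ∈ maximalIdeal (Localization.AtPrime P) ^ m ∧
      algebraMap R (Localization.AtPrime P) h ∉ maximalIdeal (Localization.AtPrime P) ^ (m + 1) := by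
  haveI : IsDomain R := isDomain_of_isRegularLocalRing R
  have hIP : Ideal.span {h} ≤ P := (Ideal.span_singleton_le_iff_mem _).mpr (Ideal.pow_le_self (by omega) hhP)
  have hh𝔪m : h ∈ maximalIdeal R ^ m :=
    Ideal.pow_right_mono (IsLocalRing.le_maximalIdeal (Ideal.IsPrime.ne_top ‹_›)) m hhP
  have hh0 : h ≠ 0 := fun h0 => hh (h0 ▸ zero_mem _)
  -- `d ≥ 1`: `P ≠ 0` since `0 ≠ h ∈ P`
  have hd1 : 1 ≤ d := by
    have hP0 : P ≠ ⊥ := fun hbot =>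
      hh0 ((Ideal.mem_bot).mp (hbot ▸ (Ideal.pow_le_self (by omega) hhP : h ∈ P)))
    have h1 : 1 ≤ P.height := by
      rw [Order.one_le_iff_ne_zero, Ne, Ideal.height_eq_zero_iff_eq_bot]
      exact hP0
    rw [height_prime_of_arc hd P hP1] at h1
    exact_mod_cast h1
  -- `H^{(0)}(A) = hypersurfaceHFe (d+1) m` (stub-1's H1′)
  have hH0 : hilbertFun (R ⧸ Ideal.span {h}) = hypersurfaceHFe (d + 1) m :=
    stub_H1_hilbertFun_quotient_span_singleton hd hh𝔪m hh
  -- the regular local ring `R_P` of dimension `d`, and the order `m'` of `h` there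
  set RP := Localization.AtPrime P with hRP
  haveI : IsRegularLocalRing RP := isRegularLocalRing_localization_atPrime R P
  have hdP : ringKrullDim RP = (d : ℕ) := ringKrullDim_localization_of_arc hd P hP1
  set h' : RP := algebraMap R RP h with hh'
  have hinj : Function.Injective (algebraMap R RP) := IsLocalization.injective RP P.primeCompl_le_nonZeroDivisors
  have hh'0 : h' ≠ 0 := fun h0 => hh0 (hinj (by rw [map_zero]; exact h0))
  obtain ⟨m', hm'1, hm'2⟩ := exists_mem_pow_and_not_mem_pow_succ hh'0
  -- `m ≤ m'`: `h ∈ P^m` maps into `(P R_P)^m = 𝔪_{R_P}^m`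
  have hmapP : P.map (algebraMap R RP) = maximalIdeal RP := Localization.AtPrime.map_eq_maximalIdeal
  have hh'm : h' ∈ maximalIdeal RP ^ m := by
    rw [← hmapP, ← Ideal.map_pow]
    exact Ideal.mem_map_of_mem _ hhP
  have hmm' : m ≤ m' := by
    by_contra hlt
    exact hm'2 (Ideal.pow_le_pow_right (by omega) hh'm)
  -- `A_P̄ ≅ R_P / (h')`
  have hinst : IsLocalization (Algebra.algebraMapSubmonoid (R ⧸ Ideal.span {h}) P.primeCompl)
      (RP ⧸ (Ideal.span {h}).map (algebraMap R RP)) :=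
    inferInstance
  rw [algebraMapSubmonoid_quotient_primeCompl R P hIP] at hinst
  haveI : IsLocalization.AtPrime (RP ⧸ (Ideal.span {h}).map (algebraMap R RP))
      (P.map (Ideal.Quotient.mk (Ideal.span {h}))) := hinst
  have hIRP : (Ideal.span {h}).map (algebraMap R RP) = Ideal.span {h'} := by
    rw [Ideal.map_span, Set.image_singleton]
  haveI hRPloc : IsLocalRing (RP ⧸ Ideal.span {h'}) :=
    isLocalRing_quotient_span_singleton_of_mem (Ideal.pow_le_self (by omega) hh'm)
  haveI : IsLocalRing (RP ⧸ (Ideal.span {h}).map (algebraMap R RP)) := by rw [hIRP]; exact hRPloc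
  let e : Ap ≃+* RP ⧸ (Ideal.span {h}).map (algebraMap R RP) :=
    (IsLocalization.algEquiv (P.map (Ideal.Quotient.mk (Ideal.span {h}))).primeCompl Ap
      (RP ⧸ (Ideal.span {h}).map (algebraMap R RP))).toRingEquiv
  let e' : (RP ⧸ (Ideal.span {h}).map (algebraMap R RP)) ≃+* RP ⧸ Ideal.span {h'} := Ideal.quotEquivOfEq hIRP
  -- `H^{(0)}(A_P̄) = hypersurfaceHFe d m'`
  haveI : IsNoetherianRing Ap :=
    IsLocalization.isNoetherianRing (P.map (Ideal.Quotient.mk (Ideal.span {h}))).primeCompl Ap inferInstance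
  have hHP : hilbertFun Ap = hypersurfaceHFe d m' := by
    rw [hilbertFun_eq_of_ringEquiv (e.trans e')]
    exact stub_H1_hilbertFun_quotient_span_singleton hdP hm'1 hm'2
  -- `H^{(1)}(A_P̄) = hypersurfaceHFe (d+1) m'`
  obtain ⟨t, rfl⟩ : ∃ t, d = t + 1 := ⟨d - 1, by omega⟩
  have hH1 : hilbertSamuelFun Ap 1 = hypersurfaceHFe (t + 1 + 1) m' := by
    rw [hilbertSamuelFun, iterPSum_succ, iterPSum_zero, hHP, psum_hypersurfaceHFe_succ]
  -- Bennett for the regular centre `A/P̄ ≅ R/P` of dimension `1`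
  let q : (R ⧸ Ideal.span {h}) ⧸ P.map (Ideal.Quotient.mk (Ideal.span {h})) ≃+* R ⧸ P :=
    DoubleQuot.quotQuotEquivQuotOfLE hIP
  haveI : IsRegularLocalRing ((R ⧸ Ideal.span {h}) ⧸ P.map (Ideal.Quotient.mk (Ideal.span {h}))) :=
    IsRegularLocalRing.of_ringEquiv q.symm
  have hdim1 : ringKrullDim ((R ⧸ Ideal.span {h}) ⧸ P.map (Ideal.Quotient.mk (Ideal.span {h}))) = (1 : ℕ) := by
    rw [ringKrullDim_eq_of_ringEquiv q, hP1]
  have hBen : hilbertSamuelFun Ap 1 ≤ hilbertFun (R ⧸ Ideal.span {h}) := by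
    have h1 := hilbertSamuelFun_localization_le_hilbertFun_of_isRegularLocalRing_quotient 1
      (P.map (Ideal.Quotient.mk (Ideal.span {h}))) hdim1
    rwa [hilbertSamuelFun_eq_of_ringEquiv
      (IsLocalization.algEquiv (P.map (Ideal.Quotient.mk (Ideal.span {h}))).primeCompl
        (Localization.AtPrime (P.map (Ideal.Quotient.mk (Ideal.span {h})))) Ap).toRingEquiv] at h1
  -- compare multiplicities
  rw [hH1, hH0] at hBen
  have hle : m' ≤ m := (hypersurfaceHFe_le_iff (by omega)).mp hBen
  have hmeq : m' = m := le_antisymm hle hmm'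
  refine ⟨?_, hH0, hmeq ▸ hm'1, hmeq ▸ hm'2⟩
  rw [hH1, hH0, hmeq]

/-! ## §3. Scheme level: `H^N(P̄) = H^N(𝔪̄)` in `Spec (R/(h))`, and the closed point is not isolated in the HS-max locus -/

/-- `H^N` of an affine scheme at a prime, read in any localization at that prime: `H^N_{Spec A}(𝔮) = H^{(N − ψ(A_𝔮))}(A_𝔮)`
(`𝒪_{Spec A,𝔮} ≅ A_𝔮`, `StructureSheaf.IsLocalization.to_stalk`). [cite: CossartJannsenSaito2020, Def. 2.28] -/
theorem hsFun_Spec_eq {A : Type u} [CommRing A] [IsNoetherianRing A] (N : ℕ) (x : ↥(Spec (CommRingCat.of A)))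
    (Aq : Type u) [CommRing Aq] [Algebra A Aq] [IsLocalization.AtPrime Aq x.asIdeal] [IsLocalRing Aq] :
    Scheme.hsFun (Spec (CommRingCat.of A)) N x = hilbertSamuelFun Aq (N - minimalPrimesCodim Aq) := by
  letI : Algebra A ((Spec (.of A)).presheaf.stalk x) := (StructureSheaf.toStalk A x).hom.toAlgebra
  have hloc : IsLocalization.AtPrime ((Spec (.of A)).presheaf.stalk x) x.asIdeal :=
    StructureSheaf.IsLocalization.to_stalk A x
  let e := (IsLocalization.algEquiv x.asIdeal.primeCompl ((Spec (.of A)).presheaf.stalk x) Aq).toRingEquiv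
  haveI : IsNoetherianRing ((Spec (.of A)).presheaf.stalk x) :=
    IsLocalization.isNoetherianRing x.asIdeal.primeCompl _ inferInstance
  rw [Scheme.hsFun_def, Scheme.hsPsi, Literature.RingTheory.HilbertSamuel.minimalPrimesCodim_eq_of_ringEquiv e,
    hilbertSamuelFun_eq_of_ringEquiv e]

/-- **H7, scheme level (D14 ROUTE H): `H^N_X(P̄) = H^N_X(𝔪̄)` in `X = Spec (R/(h))`** for every level `N ≥ d`, the arc point being
a proper generization of the closed point (`P̄ ≠ 𝔪̄`, `P̄ ⤳ 𝔪̄`): the arc lies in the Hilbert–Samuel stratum of the closed point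
(`ψ(𝔪̄) = d`, `ψ(P̄) = d − 1` for the equidimensional hypersurface `A`, and §2).
[cite: CossartJannsenSaito2020, Def. 2.28, Thm. 3.3] [cite: HerrmannIkedaOrbanz1988, Prop. (30.1)] -/
theorem hsFun_arcPoint_eq_hsFun_closedPoint {R : Type u} [CommRing R] [IsRegularLocalRing R] {d : ℕ}
    (hd : ringKrullDim R = (d + 1 : ℕ)) (P : Ideal R) [P.IsPrime] [IsRegularLocalRing (R ⧸ P)]
    (hP1 : ringKrullDim (R ⧸ P) = (1 : ℕ)) {m : ℕ} (hm : 1 ≤ m) {h : R} (hhP : h ∈ P ^ m)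
    (hh : h ∉ maximalIdeal R ^ (m + 1)) [hPb : (P.map (Ideal.Quotient.mk (Ideal.span {h}))).IsPrime]
    [IsLocalRing (R ⧸ Ideal.span {h})] {N : ℕ} (hN : d ≤ N) :
    Scheme.hsFun (Spec (CommRingCat.of (R ⧸ Ideal.span {h}))) N ⟨P.map (Ideal.Quotient.mk (Ideal.span {h})), hPb⟩ =
        Scheme.hsFun (Spec (CommRingCat.of (R ⧸ Ideal.span {h}))) N (closedPoint (R ⧸ Ideal.span {h})) ∧
      (⟨P.map (Ideal.Quotient.mk (Ideal.span {h})), hPb⟩ : ↥(Spec (CommRingCat.of (R ⧸ Ideal.span {h})))) ≠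
        closedPoint (R ⧸ Ideal.span {h}) ∧
      (⟨P.map (Ideal.Quotient.mk (Ideal.span {h})), hPb⟩ : ↥(Spec (CommRingCat.of (R ⧸ Ideal.span {h})))) ⤳
        closedPoint (R ⧸ Ideal.span {h}) := by
  haveI : IsDomain R := isDomain_of_isRegularLocalRing R
  have hIP : Ideal.span {h} ≤ P := (Ideal.span_singleton_le_iff_mem _).mpr (Ideal.pow_le_self (by omega) hhP)
  -- ring level
  obtain ⟨hH1, -, hh'm, hm'⟩ :=
    hilbertSamuelFun_one_localization_eq_hilbertFun hd P hP1 hm hhP hh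
      (Localization.AtPrime (P.map (Ideal.Quotient.mk (Ideal.span {h}))))
  have hh0 : h ≠ 0 := fun h0 => hh (h0 ▸ zero_mem _)
  have hh𝔪 : h ∈ maximalIdeal R := Ideal.pow_le_self (by omega)
    (Ideal.pow_right_mono (IsLocalRing.le_maximalIdeal (Ideal.IsPrime.ne_top ‹P.IsPrime›)) m hhP)
  have hd1 : 1 ≤ d := by
    have hP0 : P ≠ ⊥ := fun hbot =>
      hh0 ((Ideal.mem_bot).mp (hbot ▸ (Ideal.pow_le_self (by omega) hhP : h ∈ P)))
    have h1 : 1 ≤ P.height := by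
      rw [Order.one_le_iff_ne_zero, Ne, Ideal.height_eq_zero_iff_eq_bot]
      exact hP0
    rw [height_prime_of_arc hd P hP1] at h1
    exact_mod_cast h1
  -- `ψ(A) = d`
  have hψA : minimalPrimesCodim (R ⧸ Ideal.span {h}) = d := by
    rw [minimalPrimesCodim_quotient_span_singleton hd hh𝔪 hh0]
    rfl
  -- `ψ(A_P̄) = d - 1`: `A_P̄ ≅ R_P/(h')`, `R_P` regular of dimension `d`
  set RP := Localization.AtPrime P with hRP
  haveI : IsRegularLocalRing RP := isRegularLocalRing_localization_atPrime R P
  have hdP : ringKrullDim RP = (d : ℕ) := ringKrullDim_localization_of_arc hd P hP1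
  set h' : RP := algebraMap R RP h with hh'
  have hh'𝔪 : h' ∈ maximalIdeal RP := Ideal.pow_le_self (by omega) hh'm
  have hh'0 : h' ≠ 0 := fun h0 => hm' (h0 ▸ zero_mem _)
  have hinst : IsLocalization (Algebra.algebraMapSubmonoid (R ⧸ Ideal.span {h}) P.primeCompl)
      (RP ⧸ (Ideal.span {h}).map (algebraMap R RP)) :=
    inferInstance
  rw [algebraMapSubmonoid_quotient_primeCompl R P hIP] at hinst
  haveI : IsLocalization.AtPrime (RP ⧸ (Ideal.span {h}).map (algebraMap R RP))
      (P.map (Ideal.Quotient.mk (Ideal.span {h}))) := hinst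
  have hIRP : (Ideal.span {h}).map (algebraMap R RP) = Ideal.span {h'} := by
    rw [Ideal.map_span, Set.image_singleton]
  haveI hRPloc : IsLocalRing (RP ⧸ Ideal.span {h'}) := isLocalRing_quotient_span_singleton_of_mem hh'𝔪
  haveI : IsLocalRing (RP ⧸ (Ideal.span {h}).map (algebraMap R RP)) := by rw [hIRP]; exact hRPloc
  let e : Localization.AtPrime (P.map (Ideal.Quotient.mk (Ideal.span {h}))) ≃+* RP ⧸ Ideal.span {h'} :=
    (IsLocalization.algEquiv (P.map (Ideal.Quotient.mk (Ideal.span {h}))).primeCompl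
      (Localization.AtPrime (P.map (Ideal.Quotient.mk (Ideal.span {h}))))
      (RP ⧸ (Ideal.span {h}).map (algebraMap R RP))).toRingEquiv.trans (Ideal.quotEquivOfEq hIRP)
  have hψP : minimalPrimesCodim (Localization.AtPrime (P.map (Ideal.Quotient.mk (Ideal.span {h})))) = d - 1 := by
    rw [Literature.RingTheory.HilbertSamuel.minimalPrimesCodim_eq_of_ringEquiv e,
      minimalPrimesCodim_quotient_span_singleton hdP hh'𝔪 hh'0]
  -- `A ≅ A_𝔪̄`
  let e𝔪 : (R ⧸ Ideal.span {h}) ≃+* Localization.AtPrime (maximalIdeal (R ⧸ Ideal.span {h})) :=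
    (IsLocalization.atUnits (R ⧸ Ideal.span {h}) (maximalIdeal (R ⧸ Ideal.span {h})).primeCompl
      (S := Localization.AtPrime (maximalIdeal (R ⧸ Ideal.span {h}))) (by
      intro y hy
      exact not_not.mp fun hu => hy ((IsLocalRing.mem_maximalIdeal y).mpr hu))).toRingEquiv
  haveI : IsLocalization.AtPrime (Localization.AtPrime (maximalIdeal (R ⧸ Ideal.span {h})))
      (closedPoint (R ⧸ Ideal.span {h})).asIdeal :=
    (inferInstance : IsLocalization.AtPrime (Localization.AtPrime (maximalIdeal (R ⧸ Ideal.span {h})))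
      (maximalIdeal (R ⧸ Ideal.span {h})))
  -- the two `H^N`
  have hHP : Scheme.hsFun (Spec (CommRingCat.of (R ⧸ Ideal.span {h}))) N ⟨P.map (Ideal.Quotient.mk (Ideal.span {h})), hPb⟩ =
      hilbertSamuelFun (Localization.AtPrime (P.map (Ideal.Quotient.mk (Ideal.span {h})))) (N - (d - 1)) := by
    rw [hsFun_Spec_eq N (⟨P.map (Ideal.Quotient.mk (Ideal.span {h})), hPb⟩ : ↥(Spec (CommRingCat.of (R ⧸ Ideal.span {h}))))
      (Localization.AtPrime (P.map (Ideal.Quotient.mk (Ideal.span {h})))), hψP]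
  have hH𝔪 : Scheme.hsFun (Spec (CommRingCat.of (R ⧸ Ideal.span {h}))) N (closedPoint (R ⧸ Ideal.span {h})) =
      hilbertSamuelFun (R ⧸ Ideal.span {h}) (N - d) := by
    rw [hsFun_Spec_eq N (closedPoint (R ⧸ Ideal.span {h})) (Localization.AtPrime (maximalIdeal (R ⧸ Ideal.span {h}))),
      ← Literature.RingTheory.HilbertSamuel.minimalPrimesCodim_eq_of_ringEquiv e𝔪, ← hilbertSamuelFun_eq_of_ringEquiv e𝔪, hψA]
  refine ⟨?_, ?_, ?_⟩
  · rw [hHP, hH𝔪, show N - (d - 1) = (N - d) + 1 by omega, hilbertSamuelFun, iterPSum_add, ← hilbertSamuelFun,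
      hH1]
    rfl
  · -- `P̄ ≠ 𝔪̄`: `A/P̄ ≅ R/P` has dimension `1`, `A/𝔪̄` is a field
    intro heq
    have hPm : P.map (Ideal.Quotient.mk (Ideal.span {h})) = maximalIdeal (R ⧸ Ideal.span {h}) :=
      congrArg PrimeSpectrum.asIdeal heq
    let q : (R ⧸ Ideal.span {h}) ⧸ P.map (Ideal.Quotient.mk (Ideal.span {h})) ≃+* R ⧸ P :=
      DoubleQuot.quotQuotEquivQuotOfLE hIP
    have hdim1 : ringKrullDim ((R ⧸ Ideal.span {h}) ⧸ maximalIdeal (R ⧸ Ideal.span {h})) = (1 : ℕ) := by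
      rw [← hPm, ringKrullDim_eq_of_ringEquiv q, hP1]
    letI := Ideal.Quotient.field (maximalIdeal (R ⧸ Ideal.span {h}))
    rw [ringKrullDim_eq_zero_of_field] at hdim1
    exact absurd hdim1 (by norm_num)
  · -- `P̄ ⤳ 𝔪̄`
    rw [← PrimeSpectrum.le_iff_specializes]
    exact IsLocalRing.le_maximalIdeal (Ideal.IsPrime.ne_top hPb)

/-- **H7 (D14 ROUTE H): THE CLOSED POINT OF `Spec (R/(h))` IS NOT ISOLATED IN THE HILBERT–SAMUEL LOCUS** — for `R` regular local
of dimension `d + 1`, `P` a prime with `R/P` regular of dimension `1` (a regular arc through the closed point), `h ∈ P^m` with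
`h ∉ 𝔪^{m+1}`, `m ≥ 1`, and any level `N ≥ d`: the arc point `P̄` has the same `H^N` as the closed point
(`hsFun_arcPoint_eq_hsFun_closedPoint`), lies in every open neighbourhood of it, and is different from it, so no open `U` has
`U ∩ X_max = {𝔪̄}`. This is what contradicts `IsIsolatedInHSMaxLocus` at the stage `x_{n₀}` of a free-rational tail once the arc of
the bridge cut is produced (H6) and isolation is transferred to the completion (H8).
[cite: CossartJannsenSaito2020, Def. 2.35, Thm. 3.3] [cite: HerrmannIkedaOrbanz1988, Prop. (30.1)] -/
theorem not_isIsolatedInHSMaxLocus_closedPoint_of_arc {R : Type u} [CommRing R] [IsRegularLocalRing R] {d : ℕ}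
    (hd : ringKrullDim R = (d + 1 : ℕ)) (P : Ideal R) [P.IsPrime] [IsRegularLocalRing (R ⧸ P)]
    (hP1 : ringKrullDim (R ⧸ P) = (1 : ℕ)) {m : ℕ} (hm : 1 ≤ m) {h : R} (hhP : h ∈ P ^ m)
    (hh : h ∉ maximalIdeal R ^ (m + 1)) [IsLocalRing (R ⧸ Ideal.span {h})] {N : ℕ} (hN : d ≤ N) :
    ¬ IsIsolatedInHSMaxLocus (Spec (CommRingCat.of (R ⧸ Ideal.span {h}))) N (closedPoint (R ⧸ Ideal.span {h})) := by
  haveI hPb : (P.map (Ideal.Quotient.mk (Ideal.span {h}))).IsPrime :=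
    isPrime_map_quotientMk_of_mem (Ideal.pow_le_self (by omega) hhP)
  obtain ⟨hH, hne, hspec⟩ := hsFun_arcPoint_eq_hsFun_closedPoint hd P hP1 hm hhP hh (hPb := hPb) hN
  rintro ⟨U, hU, hUmax⟩
  have h𝔪 : closedPoint (R ⧸ Ideal.span {h}) ∈ U ∩ Scheme.hsMaxLocus (Spec (CommRingCat.of (R ⧸ Ideal.span {h}))) N := by
    rw [hUmax]; exact Set.mem_singleton _
  have hPU : (⟨P.map (Ideal.Quotient.mk (Ideal.span {h})), hPb⟩ : ↥(Spec (CommRingCat.of (R ⧸ Ideal.span {h})))) ∈ U :=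
    hspec.mem_open hU h𝔪.1
  have hPmax : (⟨P.map (Ideal.Quotient.mk (Ideal.span {h})), hPb⟩ : ↥(Spec (CommRingCat.of (R ⧸ Ideal.span {h})))) ∈
      Scheme.hsMaxLocus (Spec (CommRingCat.of (R ⧸ Ideal.span {h}))) N := by
    have h2 : Maximal (· ∈ Scheme.hsValues (Spec (CommRingCat.of (R ⧸ Ideal.span {h}))) N)
        (Scheme.hsFun (Spec (CommRingCat.of (R ⧸ Ideal.span {h}))) N (closedPoint (R ⧸ Ideal.span {h}))) := h𝔪.2
    show Maximal (· ∈ Scheme.hsValues (Spec (CommRingCat.of (R ⧸ Ideal.span {h}))) N)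
      (Scheme.hsFun (Spec (CommRingCat.of (R ⧸ Ideal.span {h}))) N ⟨P.map (Ideal.Quotient.mk (Ideal.span {h})), hPb⟩)
    rw [hH]
    exact h2
  have hmem : (⟨P.map (Ideal.Quotient.mk (Ideal.span {h})), hPb⟩ : ↥(Spec (CommRingCat.of (R ⧸ Ideal.span {h})))) ∈
      ({closedPoint (R ⧸ Ideal.span {h})} : Set ↥(Spec (CommRingCat.of (R ⧸ Ideal.span {h})))) :=
    hUmax ▸ ⟨hPU, hPmax⟩
  exact hne (Set.mem_singleton_iff.mp hmem)

end Summit.ResolutionOfSingularities.ResolutionOfSingularities.Theorems.SigmaMaxModificationsCorridor3.IsoTailsHS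

end
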